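import Summits.CriticalPhenomena.PercolationContinuityZ3.Theorems.Transplant.KNCells2Cover
import Summits.CriticalPhenomena.PercolationContinuityZ3.Theorems.Transplant.KNCellsReach
import HarnessLib

/-!
# F8 (generic, LAG-1 ANCHORS), part 5 — (32) along the run and LAWFULNESS of `scheme₂` (the `KNCellsReach` argument for the lag-1 scheme:
# the region anchor of the next probe out of `x` is `arr x = dep v`, exactly the anchor at which the level `j_y` certified the connection)

builds on p205010 (kernel theorem, internal audit signed; external expert review pending) — nothing in this file uses p205010.
Lane `prim-bschramm`, seat `prim-bschramm-p2`; helper file (`--supports stmt-CriticalPhenomena-4575`).  Design F8-DESIGN.md §7.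

* `pinW_F_ξ_eq₂`, `real_W₀_eq₂`; **`reach_of_probe₂`** ((32) away from the root: Step I with (31)); **`reach_root₂`**; `arr_zero₂`;
* **`valid_of_choice₂`**, **`lawful₂`** — `scheme₂` is lawful at `(p, ε)` given (32) at the root cell (`hQ0`) and the failure bound (33) after
  valid histories (`hfail`, both anchors read from the history).
[cite: KozmaNitzan2024, §4 pp. 25–31 ((29), (31), (32), Step I) — the ℤ^d model] [cite: GrimmettPercolation1999, §7.2]
-/

noncomputable section

open MeasureTheory ProbabilityTheory
open scoped ENNReal Classical

namespace Summit.CriticalPhenomena.PercolationContinuityZ3.Theorems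

namespace Transplant

namespace KNCells

open Literature.Probability.Percolation Literature.Probability.LatticeModels SimpleGraph GadgetSystem ProbeHistory HSiteScheme Contour
open Literature.Probability.Percolation.KozmaNitzan (KSch.pinW_apply_eq_of_mem)

variable {V : Type*} [DecidableEq V] [Countable V]

namespace KSchA

variable {A : Type*} {G : SimpleGraph V} [G.LocallyFinite] {S : KSchA V A}
variable (hΓ : RunGeom G S.Γ) (hA : AnchGeom S.Γ) (hsep : SepGeom₂ G S.Γ) {ω : BondConfig V}
include hΓ hA hsep

omit [Countable V] hsep in
/-- The recorded pattern is `ω ∪ U₀` on the explored edges: the two pinnings agree. [folklore] -/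
theorem pinW_F_ξ_eq₂ (n : ℕ) :
    pinW (KNLevels.lattW G S.p) ↑(S.F G (S.hst₂ G ω n)) ↑(S.ξ G (S.hst₂ G ω n)) =
      pinW (KNLevels.lattW G S.p) ↑(S.F G (S.hst₂ G ω n)) (ω ∪ ↑(S.U₀ G)) := by
  refine pinW_congr _ fun x hx => ?_
  rw [Finset.mem_coe, (runInv₂ hΓ hA ω n).ξ_iff x, Set.mem_union, Finset.mem_coe]
  exact ⟨fun h => h.2, fun h => ⟨Finset.mem_coe.1 hx, h⟩⟩

/-- `P[W₀](root ↔ M_v) = P[pinned on ω ∪ U₀](root ↔ M_v in E_i ∪ E_{w,v})` (any anchors). [cite: KozmaNitzan2024, §4 p. 28 ((32))] -/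
theorem real_W₀_eq₂ (n : ℕ) (e : Site 2 × MDir) (a b : A) :
    (prodBernoulli (S.W₀ G (S.hst₂ G ω n) e a)).real (⋃ t ∈ S.Γ.M b (tgt e), openConn S.Γ.root t) =
      (prodBernoulli (pinW (KNLevels.lattW G S.p) ↑(S.F G (S.hst₂ G ω n)) (ω ∪ ↑(S.U₀ G)))).real
        (⋃ t ∈ (↑(S.Γ.M b (tgt e)) : Set V), openConnIn (↑(S.Vx G (S.hst₂ G ω n) ∪ S.Γ.Ewv a e.1 e.2) : Set V) S.Γ.root t) := by
  have h0 : S.Γ.root ∈ (↑(S.Vx G (S.hst₂ G ω n) ∪ S.Γ.Ewv a e.1 e.2) : Set V) :=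
    Finset.mem_coe.2 (Finset.mem_union_left _ (root_mem_V₂ hΓ hsep.root_mem n))
  rw [W₀, ← Finset.set_biUnion_coe, prodBernoulli_restrW_real_biUnion_openConn _ _ h0, pinW_F_ξ_eq₂ hΓ hA]

/-- **(32) away from the root cell** (KN p. 28 and Step I): if `w = tgt e` was examined at time `m < n` and its connection to the still
undetermined `x = w + du` was good at level `j_x` (departure anchor and level read off the observation), then
`P(root ↔ M_x in E_n ∪ E_{w,x} | ω|_{E_n}) > 1 - δ`, everything at `w`'s (frozen) departure anchor. [cite: KozmaNitzan2024, §4 p. 28 ((32) for w ≠ 0)] -/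
theorem reach_of_probe₂ {n m : ℕ} (hm : m < n) {e : Site 2 × MDir}
    (hc : ((S.scheme₂ G).stN m ω).choice = some e) (hV : S.Valid₂ G (S.hst₂ G ω m) e)
    (hD : (S.scheme₂ G).E.next (S.hst₂ G ω m) = some (S.probe₂ G (S.hst₂ G ω m) e (S.aOf₁ G (S.hst₂ G ω m) e) (S.aOf₂ G (S.hst₂ G ω m) e))) {du : MDir}
    (hv : ¬((S.scheme₂ G).stN n ω).Det (tgt e + stepVec du))
    (hcond : S.cond G (S.hst₂ G ω m) e (S.aOf₁ G (S.hst₂ G ω m) e) (S.aOf₂ G (S.hst₂ G ω m) e) du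
      (S.jOf G (S.hst₂ G ω m) e (S.aOf₁ G (S.hst₂ G ω m) e) (S.aOf₂ G (S.hst₂ G ω m) e) du (S.oOf₂ G ω (S.hst₂ G ω m) e))
      (S.oOf₂ G ω (S.hst₂ G ω m) e)) :
    1 - S.δc < (prodBernoulli (S.W₀ G (S.hst₂ G ω n) (tgt e, du) (S.aOf₂ G (S.hst₂ G ω m) e))).real
      (⋃ t ∈ S.Γ.M (S.aOf₂ G (S.hst₂ G ω m) e) (tgt (tgt e, du)), openConn S.Γ.root t) := by
  set hm_ := S.hst₂ G ω m with hhm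
  set a := S.aOf₁ G hm_ e with hadef
  set o := S.oOf₂ G ω hm_ e with ho
  set a' := S.aOf₂ G hm_ e with ha'def
  set j := S.jOf G hm_ e a a' du o with hjdef
  have hI := runInv₂ hΓ hA ω n
  have hIm := runInv₂ hΓ hA ω m
  have hdu : du ∈ S.onward G hm_ (tgt e) := mem_onward_of_not_det₂ hΓ hA hsep hm.le hv
  have hjK : j < S.Γ.K := S.jOf_lt _ _ _ _ _ _
  have ha' : a' ∈ S.Γ.anchSet a (tgt e) := hIm.anch e.1 (tgt e)
  -- `Fj_m ⊆ F_n`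
  have hF1 : S.F G (S.hst₂ G ω (m + 1)) = S.F G hm_ ∪ S.revealOf₂ G hm_ e a a' o := (S.step_some₂ hc hD).1
  have hFjF : S.Fj G hm_ e a a' du j ⊆ S.F G (S.hst₂ G ω n) := by
    intro x hx
    by_cases hxF : x ∈ S.F G hm_
    · exact S.F_mono₂ ω hm.le hxF
    · have h1 : x ∈ S.revealOf₂ G hm_ e a a' o := S.Fj_sdiff_subset_revealOf₂ hdu le_rfl (Finset.mem_sdiff.2 ⟨hx, hxF⟩)
      refine S.F_mono₂ ω (Nat.succ_le_of_lt hm) ?_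
      show x ∈ S.F G (S.hst₂ G ω (m + 1))
      rw [hF1]; exact Finset.mem_union_right _ h1
  -- `F_n ∩ wireSet(Sx_m) ⊆ Fj_m` ((31))
  have hkey : ∀ x ∈ S.F G (S.hst₂ G ω n), x ∈ wireSet (↑(S.Sx G hm_ e a a' du) : Set V) → x ∈ S.Fj G hm_ e a a' du j := by
    intro x hx hxS
    rw [hI.F_eq, mem_edgesIn_iff] at hx
    rw [Fj, mem_edgesIn_iff]
    refine ⟨hx.1, fun y hy => ?_⟩
    have hyV := hx.2 y hy
    have hyS := Finset.mem_coe.1 (hxS.1 y hy)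
    rcases Finset.mem_union.1 hyS with hyS | hyS
    · exact Finset.mem_union_left _ hyS
    · exact Finset.mem_union_right _ (mem_Stub_of_mem_V_of_mem_Efar₂ hΓ hA hsep hm hc hV hD hv hyV hyS)
  -- the weights agree on `wireSet(Sx_m)`
  have hpq : ∀ x ∈ wireSet (↑(S.Sx G hm_ e a a' du) : Set V),
      pinW (KNLevels.lattW G S.p) ↑(S.Fj G hm_ e a a' du j) ↑(S.pat G hm_ e a a' du j o) x =
        pinW (KNLevels.lattW G S.p) ↑(S.F G (S.hst₂ G ω n)) (ω ∪ ↑(S.U₀ G)) x := by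
    intro x hxS
    by_cases hxj : x ∈ S.Fj G hm_ e a a' du j
    · refine KSch.pinW_apply_eq_of_mem _ (Finset.mem_coe.2 hxj) (Finset.mem_coe.2 (hFjF hxj)) ?_
      rw [Finset.mem_coe, pat, Finset.mem_union, Finset.mem_inter, Finset.mem_sdiff, ho, mem_obs_iff, Set.mem_union,
        Finset.mem_coe]
      by_cases hxF : x ∈ S.F G hm_
      · rw [hIm.ξ_iff x]
        constructor
        · rintro (⟨-, h'⟩ | ⟨-, -, h'⟩)
          · exact h'
          · exact absurd hxF h'
        · intro h'; exact Or.inl ⟨hxF, h'⟩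
      · have hxenv : x ∈ S.env₂ G hm_ e a a' := S.Fj_sdiff_subset_env₂ hm_ e a a' hdu hjK (Finset.mem_sdiff.2 ⟨hxj, hxF⟩)
        have hxU : x ∉ S.U₀ G := fun h' => hxF (S.U₀_subset_F _ h')
        constructor
        · rintro (h' | ⟨⟨-, h'⟩, -, -⟩)
          · exact absurd (hV.ξ_sub h') hxF
          · exact Or.inl h'
        · rintro (h' | h')
          · exact Or.inr ⟨⟨hxenv, h'⟩, hxj, hxF⟩
          · exact absurd h' hxU
    · have hxF : x ∉ S.F G (S.hst₂ G ω n) := fun h' => hxj (hkey x h' hxS)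
      rw [pinW_apply_of_not_mem _ _ (fun h' => hxj (Finset.mem_coe.1 h')),
        pinW_apply_of_not_mem _ _ (fun h' => hxF (Finset.mem_coe.1 h'))]
  -- `Sx_m ⊆ E_n ∪ E_{w,x}`
  have hSx : (↑(S.Sx G hm_ e a a' du) : Set V) ⊆ ↑(S.Vx G (S.hst₂ G ω n) ∪ S.Γ.Ewv a' (tgt e) du) := by
    refine Finset.coe_subset.2 fun y hy => ?_
    rcases Finset.mem_union.1 hy with hy | hy
    · rcases Finset.mem_union.1 hy with hy | hy
      · exact Finset.mem_union_left _ (S.V_mono₂ ω hm.le hy)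
      · exact Finset.mem_union_left _ (newRegion_subset_V₂ hΓ hA hm hc hD (Finset.mem_union_left _ hy))
    · exact Finset.mem_union_right _ (hsep.Efar_subset_Btw_union_Q _ _ _ hy)
  have h0S : S.Γ.root ∈ (↑(S.Sx G hm_ e a a' du) : Set V) :=
    Finset.mem_coe.2 (Finset.mem_union_left _ (Finset.mem_union_left _ hV.root_mem))
  -- the chain
  have e1 : (prodBernoulli (S.Wt G hm_ e a a' du j o)).real (S.Conn a' e du) =
      (prodBernoulli (pinW (KNLevels.lattW G S.p) ↑(S.Fj G hm_ e a a' du j) ↑(S.pat G hm_ e a a' du j o))).real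
        (⋃ t ∈ (↑(S.Γ.M a' (tgt e + stepVec du)) : Set V), openConnIn (↑(S.Sx G hm_ e a a' du) : Set V) S.Γ.root t) := by
    rw [Conn, Wt, ← Finset.set_biUnion_coe, prodBernoulli_restrW_real_biUnion_openConn _ _ h0S]
  have e2 : (prodBernoulli (pinW (KNLevels.lattW G S.p) ↑(S.Fj G hm_ e a a' du j) ↑(S.pat G hm_ e a a' du j o))).real
        (⋃ t ∈ (↑(S.Γ.M a' (tgt e + stepVec du)) : Set V), openConnIn (↑(S.Sx G hm_ e a a' du) : Set V) S.Γ.root t) =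
      (prodBernoulli (pinW (KNLevels.lattW G S.p) ↑(S.F G (S.hst₂ G ω n)) (ω ∪ ↑(S.U₀ G)))).real
        (⋃ t ∈ (↑(S.Γ.M a' (tgt e + stepVec du)) : Set V), openConnIn (↑(S.Sx G hm_ e a a' du) : Set V) S.Γ.root t) :=
    prodBernoulli_real_eq_of_determinedBy _ _ hpq (determinedBy_biUnion_openConnIn _ _ _ subset_rfl)
      (measurableSet_biUnion_openConnIn _ _ _)
  have e3 : (prodBernoulli (pinW (KNLevels.lattW G S.p) ↑(S.F G (S.hst₂ G ω n)) (ω ∪ ↑(S.U₀ G)))).real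
        (⋃ t ∈ (↑(S.Γ.M a' (tgt e + stepVec du)) : Set V), openConnIn (↑(S.Sx G hm_ e a a' du) : Set V) S.Γ.root t) ≤
      (prodBernoulli (pinW (KNLevels.lattW G S.p) ↑(S.F G (S.hst₂ G ω n)) (ω ∪ ↑(S.U₀ G)))).real
        (⋃ t ∈ (↑(S.Γ.M a' (tgt e + stepVec du)) : Set V),
          openConnIn (↑(S.Vx G (S.hst₂ G ω n) ∪ S.Γ.Ewv a' (tgt e) du) : Set V) S.Γ.root t) :=
    measureReal_mono (biUnion_openConnIn_mono hSx _ subset_rfl) (measure_ne_top _ _)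
  have hc' : 1 - S.δc < (prodBernoulli (S.Wt G hm_ e a a' du j o)).real (S.Conn a' e du) := hcond
  rw [real_W₀_eq₂ hΓ hA hsep]
  change 1 - S.δc < (prodBernoulli (pinW (KNLevels.lattW G S.p) ↑(S.F G (S.hst₂ G ω n)) (ω ∪ ↑(S.U₀ G)))).real
    (⋃ t ∈ (↑(S.Γ.M a' (tgt e + stepVec du)) : Set V),
      openConnIn (↑(S.Vx G (S.hst₂ G ω n) ∪ S.Γ.Ewv a' (tgt e) du) : Set V) S.Γ.root t)
  rw [e1, e2] at hc'
  exact lt_of_lt_of_le hc' e3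

/-- **(32) at the root cell** (KN p. 28): the root cube is wired open, and by the choice of the scale (`hQ0`, "the definition of `m₂`")
`M^{a₀}_0` is joined to `M^{a₀}_x` inside `Q_0 ∪ E_{0,x}` with probability `> 1 - δ`. [cite: KozmaNitzan2024, §4 p. 28 ((32) for w = 0)] -/
theorem reach_root₂ {n : ℕ} {du : MDir} (hv : ¬((S.scheme₂ G).stN n ω).Det ((0 : Site 2) + stepVec du))
    (hQ0 : 1 - S.δc < (prodBernoulli (pinW (KNLevels.lattW G S.p) ↑(S.U₀ G) ↑(S.U₀ G))).real
      (⋃ t ∈ (↑(S.Γ.M S.Γ.a₀ ((0 : Site 2) + stepVec du)) : Set V),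
        openConnIn (↑(S.Γ.Q S.Γ.a₀ 0 ∪ S.Γ.Ewv S.Γ.a₀ 0 du) : Set V) S.Γ.root t)) :
    1 - S.δc < (prodBernoulli (S.W₀ G (S.hst₂ G ω n) ((0 : Site 2), du) S.Γ.a₀)).real
      (⋃ t ∈ S.Γ.M S.Γ.a₀ (tgt ((0 : Site 2), du)), openConn S.Γ.root t) := by
  have hI := runInv₂ hΓ hA ω n
  have hQ0V : S.Γ.Q S.Γ.a₀ 0 ⊆ S.Vx G (S.hst₂ G ω n) := hI.Q0_sub
  -- `F_n ∩ wireSet(Q_0 ∪ E_{0,x}) ⊆ U₀`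
  have hkey : ∀ x ∈ S.F G (S.hst₂ G ω n), x ∈ wireSet (↑(S.Γ.Q S.Γ.a₀ 0 ∪ S.Γ.Ewv S.Γ.a₀ 0 du) : Set V) → x ∈ S.U₀ G := by
    intro x hx hxS
    rw [hI.F_eq, mem_edgesIn_iff] at hx
    rw [U₀, mem_edgesIn_iff]
    refine ⟨hx.1, fun y hy => ?_⟩
    rcases Finset.mem_union.1 (Finset.mem_coe.1 (hxS.1 y hy)) with h | h
    · exact h
    · exact absurd h (not_mem_Ewv_root_of_mem_V₂ hΓ hA hsep hv (hx.2 y hy))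
  have hpq : ∀ x ∈ wireSet (↑(S.Γ.Q S.Γ.a₀ 0 ∪ S.Γ.Ewv S.Γ.a₀ 0 du) : Set V),
      pinW (KNLevels.lattW G S.p) ↑(S.U₀ G) ↑(S.U₀ G) x =
        pinW (KNLevels.lattW G S.p) ↑(S.F G (S.hst₂ G ω n)) (ω ∪ ↑(S.U₀ G)) x := by
    intro x hxS
    by_cases hxF : x ∈ S.F G (S.hst₂ G ω n)
    · have hxU : x ∈ S.U₀ G := hkey x hxF hxS
      refine KSch.pinW_apply_eq_of_mem _ (Finset.mem_coe.2 hxU) (Finset.mem_coe.2 hxF) ?_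
      simp only [Finset.mem_coe, Set.mem_union, hxU, or_true]
    · have hxU : x ∉ S.U₀ G := fun h' => hxF (S.U₀_subset_F _ h')
      rw [pinW_apply_of_not_mem _ _ (fun h' => hxU (Finset.mem_coe.1 h')),
        pinW_apply_of_not_mem _ _ (fun h' => hxF (Finset.mem_coe.1 h'))]
  have hsub : (↑(S.Γ.Q S.Γ.a₀ 0 ∪ S.Γ.Ewv S.Γ.a₀ 0 du) : Set V) ⊆ ↑(S.Vx G (S.hst₂ G ω n) ∪ S.Γ.Ewv S.Γ.a₀ 0 du) :=
    Finset.coe_subset.2 (Finset.union_subset_union hQ0V le_rfl)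
  have e2 : (prodBernoulli (pinW (KNLevels.lattW G S.p) ↑(S.U₀ G) ↑(S.U₀ G))).real
        (⋃ t ∈ (↑(S.Γ.M S.Γ.a₀ ((0 : Site 2) + stepVec du)) : Set V),
          openConnIn (↑(S.Γ.Q S.Γ.a₀ 0 ∪ S.Γ.Ewv S.Γ.a₀ 0 du) : Set V) S.Γ.root t) =
      (prodBernoulli (pinW (KNLevels.lattW G S.p) ↑(S.F G (S.hst₂ G ω n)) (ω ∪ ↑(S.U₀ G)))).real
        (⋃ t ∈ (↑(S.Γ.M S.Γ.a₀ ((0 : Site 2) + stepVec du)) : Set V),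
          openConnIn (↑(S.Γ.Q S.Γ.a₀ 0 ∪ S.Γ.Ewv S.Γ.a₀ 0 du) : Set V) S.Γ.root t) :=
    prodBernoulli_real_eq_of_determinedBy _ _ hpq (determinedBy_biUnion_openConnIn _ _ _ subset_rfl)
      (measurableSet_biUnion_openConnIn _ _ _)
  have e3 : (prodBernoulli (pinW (KNLevels.lattW G S.p) ↑(S.F G (S.hst₂ G ω n)) (ω ∪ ↑(S.U₀ G)))).real
        (⋃ t ∈ (↑(S.Γ.M S.Γ.a₀ ((0 : Site 2) + stepVec du)) : Set V),
          openConnIn (↑(S.Γ.Q S.Γ.a₀ 0 ∪ S.Γ.Ewv S.Γ.a₀ 0 du) : Set V) S.Γ.root t) ≤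
      (prodBernoulli (pinW (KNLevels.lattW G S.p) ↑(S.F G (S.hst₂ G ω n)) (ω ∪ ↑(S.U₀ G)))).real
        (⋃ t ∈ (↑(S.Γ.M S.Γ.a₀ ((0 : Site 2) + stepVec du)) : Set V),
          openConnIn (↑(S.Vx G (S.hst₂ G ω n) ∪ S.Γ.Ewv S.Γ.a₀ 0 du) : Set V) S.Γ.root t) :=
    measureReal_mono (biUnion_openConnIn_mono hsub _ subset_rfl) (measure_ne_top _ _)
  rw [real_W₀_eq₂ hΓ hA hsep]
  rw [e2] at hQ0
  exact lt_of_lt_of_le hQ0 e3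

omit [Countable V] hsep in
/-- Along the run the root's region anchor is the root anchor. [folklore] -/
theorem arr_zero₂ (n : ℕ) : (S.astOf₂ G (S.hst₂ G ω n)).arr 0 = S.Γ.a₀ := (runInv₂ hΓ hA ω n).arr_zero

/-- **Every history of the run at which an edge is chosen is valid** ((29) both halves, the anchored cover, and (32)).
[cite: KozmaNitzan2024, §4 pp. 26–28 ((29), (31), (32))] -/
theorem valid_of_choice₂
    (hQ0 : ∀ du : MDir, 1 - S.δc < (prodBernoulli (pinW (KNLevels.lattW G S.p) ↑(S.U₀ G) ↑(S.U₀ G))).real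
      (⋃ t ∈ (↑(S.Γ.M S.Γ.a₀ ((0 : Site 2) + stepVec du)) : Set V),
        openConnIn (↑(S.Γ.Q S.Γ.a₀ 0 ∪ S.Γ.Ewv S.Γ.a₀ 0 du) : Set V) S.Γ.root t))
    {n : ℕ} {e : Site 2 × MDir} (hc : ((S.scheme₂ G).stN n ω).choice = some e) : S.Valid₂ G (S.hst₂ G ω n) e := by
  have hI := runInv₂ hΓ hA ω n
  obtain ⟨he1, he2⟩ := HState.cand_of_choice hc
  refine ⟨hI.F_eq, fun x hx => ((hI.ξ_iff x).1 hx).1, root_mem_V₂ hΓ hsep.root_mem n, col_of_det₂ hΓ hA hsep (Or.inl he1),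
    hI.anch e.1 (tgt e), ?_, ?_⟩
  · refine ⟨{x | ((S.scheme₂ G).stN n ω).Det x}, he2, fun du hdu hdet => ?_, V_subset_Cover₂ hΓ hA hsep n⟩
    obtain ⟨y, hy, hyc⟩ := col_of_det₂ hΓ hA hsep hdet
    exact (Finset.mem_filter.1 hdu).2 y hy hyc
  · obtain ⟨w, du⟩ := e
    rcases (S.scheme₂ G).exists_probe_of_det ω n w (Or.inl he1) with hw0 | ⟨m, hm, e₀, P, hc₀, ht₀, hP, hocc⟩
    · subst hw0
      show 1 - S.δc < (prodBernoulli (S.W₀ G (S.hst₂ G ω n) ((0 : Site 2), du) ((S.astOf₂ G (S.hst₂ G ω n)).arr 0))).real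
        (⋃ t ∈ S.Γ.M ((S.astOf₂ G (S.hst₂ G ω n)).arr 0) (tgt ((0 : Site 2), du)), openConn S.Γ.root t)
      rw [arr_zero₂ hΓ hA]
      exact reach_root₂ hΓ hA hsep he2 (hQ0 du)
    · obtain ⟨e₁, hc₁, hV₀, rfl⟩ := S.of_next_some₂ hP
      rw [hc₀] at hc₁
      cases Option.some_injective _ hc₁
      subst ht₀
      have hsucc : S.succ₂ G (S.hst₂ G ω m) e₀ (S.aOf₁ G (S.hst₂ G ω m) e₀) (S.aOf₂ G (S.hst₂ G ω m) e₀) (S.oOf₂ G ω (S.hst₂ G ω m) e₀) :=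
        (S.succ₂_read_iff _ _ _ _ _).1 (hocc.1 he1)
      have hdu : du ∈ S.onward G (S.hst₂ G ω m) (tgt e₀) := mem_onward_of_not_det₂ hΓ hA hsep hm.le he2
      have harr : (S.astOf₂ G (S.hst₂ G ω n)).arr (tgt e₀) = S.aOf₂ G (S.hst₂ G ω m) e₀ := (anchors_tgt_of_probe₂ hm hc₀ hP).1
      show 1 - S.δc < (prodBernoulli (S.W₀ G (S.hst₂ G ω n) (tgt e₀, du) ((S.astOf₂ G (S.hst₂ G ω n)).arr (tgt e₀)))).real
        (⋃ t ∈ S.Γ.M ((S.astOf₂ G (S.hst₂ G ω n)).arr (tgt e₀)) (tgt (tgt e₀, du)), openConn S.Γ.root t)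
      rw [harr]
      exact reach_of_probe₂ hΓ hA hsep hm hc₀ hV₀ hP he2 (hsucc du hdu)

/-- **The anchored exploration process is lawful**, given (32) at the root cell (`hQ0`) and the failure bound (33) after valid histories
(`hfail`, at the source anchor replayed from the history). [cite: KozmaNitzan2024, §4 pp. 25–31] -/
theorem lawful₂ {ε : ℝ}
    (hQ0 : ∀ du : MDir, 1 - S.δc < (prodBernoulli (pinW (KNLevels.lattW G S.p) ↑(S.U₀ G) ↑(S.U₀ G))).real
      (⋃ t ∈ (↑(S.Γ.M S.Γ.a₀ ((0 : Site 2) + stepVec du)) : Set V),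
        openConnIn (↑(S.Γ.Q S.Γ.a₀ 0 ∪ S.Γ.Ewv S.Γ.a₀ 0 du) : Set V) S.Γ.root t))
    (hfail : ∀ h e, S.Valid₂ G h e →
      (bondPercolation G S.p).real {ω | ¬S.succ₂ G h e (S.aOf₁ G h e) (S.aOf₂ G h e) ((S.probe₂ G h e (S.aOf₁ G h e) (S.aOf₂ G h e)).read ω)} ≤ ε) :
    (S.scheme₂ G).Lawful G S.p ε where
  fresh := by
    intro h P hP
    obtain ⟨e, -, -, rfl⟩ := S.nextProbe₂_eq_some hP
    constructor
    · rw [Set.disjoint_left]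
      intro x hx hxU
      exact (Finset.mem_sdiff.1 (Finset.mem_coe.1 hx)).2 (S.U₀_subset_F _ (Finset.mem_coe.1 hxU))
    · rw [Finset.disjoint_left]
      intro x hx hxs
      exact (Finset.mem_sdiff.1 hx).2 (Finset.mem_union_right _ hxs)
  probes := by
    intro ω _ n hc
    obtain ⟨e, he⟩ := Option.ne_none_iff_exists'.1 hc
    have hV : S.Valid₂ G (S.hst₂ G ω n) e := valid_of_choice₂ hΓ hA hsep hQ0 he
    have he' : (S.astOf₂ G (S.hst₂ G ω n)).st.choice = some e := by rw [← S.stN_eq₂]; exact he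
    show S.nextProbe₂ G (S.hst₂ G ω n) ≠ none
    rw [S.nextProbe₂_of_valid he' hV]
    exact Option.some_ne_none _
  fail := by
    intro h P e hP hc
    obtain ⟨e', hc', hV, rfl⟩ := S.nextProbe₂_eq_some hP
    have hc'' : (S.astOf₂ G h).st.choice = some e := by rw [← S.scheme₂_mst]; exact hc
    have hcc : some e' = some e := hc'.symm.trans hc''
    cases Option.some_injective _ hcc
    exact hfail h _ hV

end KSchA

end KNCells

end Transplant

end Summit.CriticalPhenomena.PercolationContinuityZ3.Theorems

end
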